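import Summits.QuantumFields.YangMills.Theorems.FluctuationComparisonRegPrIntLS2BetaTreeGaugeChartLocal
import Summits.QuantumFields.YangMills.Theorems.FluctuationComparisonRegPrIntLS2BetaExpChartOpenBall
import Literature.MathematicalPhysics.QuantumFieldTheory.Balaban1983to89.HaarWindowConstLimit
import HarnessLib

/-!
# (C3) THE TUBULAR HAAR CHART OF A TREE GAUGE — LOCAL EDITION, WINDOW NAMED, WITH THE COVER ∕ INNER-RADIUS ROW ((Q-TUBE)(ii))

Crux `stmt-QuantumFields-20520` (`…Theses.UnitScaleTilt.FluctuationComparisonRegPrIntL`), LINE g18-1 S2β, organ (C3) ∕ DET-REP (B) (Q-TUBE)(ii); cell `ym3-torus`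
(HUMAN RULING D-0037 — rung R3, not Clay), width seat `ym3-torus-px21` g17 (lineage of g11's ✓`…TreeGaugeChartLocal`); count-neutral helper
(`--kind proof --supports stmt-QuantumFields-20520 --as helper`).  Theorems only: 0 `def`, 0 `instance`, 0 `notation`, 0 `sorry`.
WHY (ymfull-r3-prover-4 g0, «INNER RADIUS of px21's slice»).  The DET-REP (B) corner hands read fine fields through the tubular chart `Θ'(z, y) = (e z) • (σ y)`
of ✓`exists_tubularChart_of_treeGauge_local`, whose free-bond window `UV` is existential there; by the construction (`σ y = Ξ (w₀, u₀ · Θ^{β∖F}(eV y))`,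
`UV = eV⁻¹ B(0, s_C∕2)`) the saturated slice `(residual gauge group) • σ(UV)` contains EVERY field whose comb-gauge free-bond readings lie in the canonical
windows `u₀(b) · Θ(B(0, s_C∕2))` bond by bond — `s_C = IsChartRep.chartRadius C` the ONE-BOND chart radius, DEPTH-UNIFORM (no `β`, `ι`, `U₀`).
WHAT.  ★★★ `exists_tubularChart_of_treeGauge_local_cover` = every row of the parent VERBATIM + (F5) `UV = eV ⁻¹' B(0, s_C∕2)` + (F6) the cover row; same
construction and proof, over ✓`…S2BetaExpChartOpenBall.exists_haarChart_expChart_frame_open_ball` (window named) and `chartRadius_piLogChart`; (F6) =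
`Ξ (Ψ V') = V'` (✓`xi_psi`) + lit ✓`expChart_pi_apply` ∕ ✓`norm_lt_iff_pi` + the identity `Ξ ((g V')⁻¹, u) = ((g V')⁻¹ g U₀) • Ξ ((g U₀)⁻¹, u)`.
HONEST SCOPE.  Point-set ∕ group-algebra ∕ measure bookkeeping; nothing of Bałaban's analysis; (Q-TUBE)(i), DET-REP (B), S2β, stmt-QuantumFields-20520 NOT
proved; rung R3 = YM₃ on T³ — NOT d = 4, NOT infinite volume, NOT a mass gap, NOT Clay.
[cite: Helgason2000, Ch. I §1 Thm 1.14 (13) p.96; Balaban1985Averaging, (8), (10) p.18; Balaban1985Variational, (19) p.281, Thm 1 (10) p.279; Balaban1985UV3, (18) p.260]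
-/

noncomputable section

open MeasureTheory MeasureTheory.Measure Set Function Filter Topology
open scoped ENNReal
open Literature.MathematicalPhysics.QuantumFieldTheory.Balaban1983to89
open Literature.MathematicalPhysics.QuantumFieldTheory.Balaban1983to89.HaarExponentialChart
open Literature.MathematicalPhysics.QuantumFieldTheory.Balaban1983to89.LogChartProduct
open Literature.Analysis.Asymptotics

namespace Summit.QuantumFields.YangMills.Theorems.FluctuationComparisonRegPrIntLS2BetaTreeGaugeChartLocalCover

open Summit.QuantumFields.YangMills.Theorems.FluctuationComparisonRegPrIntLS2BetaTreeGaugeAlgebra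
open Summit.QuantumFields.YangMills.Theorems.FluctuationComparisonRegPrIntLS2BetaTreeGaugeHaar
open Summit.QuantumFields.YangMills.Theorems.FluctuationComparisonRegPrIntLS2BetaTreeGaugeChartTransversal
  (exists_sq_norm_le_sum_norm_exp_sub_one_sq)
open Summit.QuantumFields.YangMills.Theorems.FluctuationComparisonRegPrIntLS2BetaExpChartOpen (exists_haarChart_expChart_frame_open)
open Summit.QuantumFields.YangMills.Theorems.FluctuationComparisonRegPrIntLS2BetaExpChartOpenBall
  (chartRadius_piLogChart exists_haarChart_expChart_frame_open_ball)
open Literature.MathematicalPhysics.QuantumFieldTheory.Balaban1983to89.B13HaarSigmaJacobian (jac)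

variable {𝔸 : Type*} [NormedRing 𝔸] [NormedAlgebra ℂ 𝔸] [CompleteSpace 𝔸]
variable {G : Type*} [Group G] [TopologicalSpace G] [IsTopologicalGroup G] [CompactSpace G] [T2Space G]
  [MeasurableSpace G] [BorelSpace G] [SecondCountableTopology G]
variable {C : LogChart 𝔸} {ρ : G →* 𝔸} (h : IsChartRep C ρ) [FiniteDimensional ℝ C.lie]
  (hlie : ∀ x ∈ C.lie, ∀ y ∈ C.lie, x * y - y * x ∈ C.lie)
variable (μG : Measure G) [μG.IsHaarMeasure] [IsProbabilityMeasure μG]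
variable {ι β : Type*} [Fintype ι] [Fintype β]
  (s t : β → ι) (R : Set ι) [DecidablePred (· ∈ R)] (F : Set β) [DecidablePred (· ∈ F)]
  (g : (β → G) → (ι → G))
variable [MeasurableSpace (piLogChart C {x // x ∉ R}).lie] [BorelSpace (piLogChart C {x // x ∉ R}).lie]
variable [MeasurableSpace (piLogChart C {b // b ∉ F}).lie] [BorelSpace (piLogChart C {b // b ∉ F}).lie]
  [FiniteDimensional ℝ (piLogChart C {b // b ∉ F}).lie]
variable {Z : Type*} [NormedAddCommGroup Z] [InnerProductSpace ℝ Z] [FiniteDimensional ℝ Z] [MeasurableSpace Z] [BorelSpace Z]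
  (eZ : Z ≃L[ℝ] (piLogChart C {x // x ∉ R}).lie)
variable {V : Type*} [NormedAddCommGroup V] [InnerProductSpace ℝ V] [FiniteDimensional ℝ V] [MeasurableSpace V] [BorelSpace V]
  (eV : V ≃L[ℝ] (piLogChart C {b // b ∉ F}).lie)

set_option maxHeartbeats 400000 in
include h hlie eZ eV in
/-- ★★★ **THE TUBULAR HAAR CHART OF A TREE GAUGE — LOCAL EDITION, WINDOW NAMED, WITH THE COVER ROW**: every row of
✓`…TreeGaugeChartLocal.exists_tubularChart_of_treeGauge_local` VERBATIM, PLUS **(F5)** `UV = eV ⁻¹' B(0, s_C∕2)` (`s_C = IsChartRep.chartRadius C`, the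
ONE-BOND chart radius — DEPTH-UNIFORM) and **(F6) COVER ∕ INNER RADIUS**: every field `V'` whose comb-gauge free-bond readings satisfy
`(g U₀ (s b) U₀ b (g U₀ (t b))⁻¹)⁻¹ · (g V' (s b) V' b (g V' (t b))⁻¹) ∈ Θ(B(0, s_C∕2))` (`b ∉ F`) IS `a • σ y` for some `y ∈ UV`, with the EXPLICIT root-trivial
residual transformation `a := (g V')⁻¹ · g U₀` (`a r = 1` on `R` by `hgR`). [cite: Helgason2000, Ch. I §1 Thm 1.14 (13) p. 96; Balaban1985UV3, (18) p. 260; Balaban1985Averaging, (8), (10) p.18;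
Balaban1985Variational, (19) p.281, Thm 1 (10) p.279] -/
theorem exists_tubularChart_of_treeGauge_local_cover (hgc : Continuous g) (hgR : ∀ V, ∀ r ∈ R, g V r = 1)
    (hcov : ∀ (a : ι → G), (∀ r ∈ R, a r = 1) → ∀ (V : β → G) (x : ι),
      g (fun b => a (s b) * V b * (a (t b))⁻¹) x = g V x * (a x)⁻¹)
    (hkill : ∀ V, ∀ b ∈ F, g V (s b) * V b * (g V (t b))⁻¹ = 1)
    (hloc : ∀ V V' : β → G, (∀ b ∈ F, V b = V' b) → g V = g V') (hg1 : g (fun _ => 1) = fun _ => 1)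
    (U₀ : β → G) :
    ∃ (e : Z → (ι → G)) (σ : V → (β → G)) (UZ : Set Z) (UV : Set V) (dZ : Z → ℝ) (dV : V → ℝ),
      Continuous e ∧ e 0 = 1 ∧ (∀ z, ∀ r ∈ R, e z r = 1) ∧
      (∀ sZ ∈ 𝓝 (0 : Z), ∃ tt ∈ 𝓝 (1 : ι → G), ∀ w ∈ tt, (∀ r ∈ R, w r = 1) → w ∈ e '' sZ) ∧
      Continuous σ ∧ σ 0 = U₀ ∧ ContDiff ℝ ⊤ (fun y : V => fun b : β => (ρ (σ y b) : 𝔸)) ∧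
      (∀ y, ∀ b ∈ F, σ y b = U₀ b) ∧ (∀ y, g (σ y) = g U₀) ∧
      (∀ y, ∀ (b : β) (hb : b ∉ F), σ y b =
        U₀ b * ((g U₀ (t b))⁻¹ * h.expChart (lieApply C {b // b ∉ F} (eV y) ⟨b, hb⟩) * g U₀ (t b))) ∧
      (∃ c : ℝ, 0 < c ∧ ∀ᶠ y in 𝓝 (0 : V), c * ‖y‖ ^ 2 ≤
        ∑ b : {b // b ∉ F}, ‖ρ ((g U₀ (s b) * U₀ b * (g U₀ (t b))⁻¹)⁻¹ * (g (σ y) (s b) * σ y b * (g (σ y) (t b))⁻¹)) - 1‖ ^ 2) ∧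
      IsOpen UZ ∧ IsOpen UV ∧ (0 : Z) ∈ UZ ∧ (0 : V) ∈ UV ∧
      InjOn (fun p : Z × V => fun b : β => e p.1 (s b) * σ p.2 b * (e p.1 (t b))⁻¹) (UZ ×ˢ UV) ∧
      (∀ sW ∈ 𝓝 ((0 : Z), (0 : V)), (fun p : Z × V => fun b : β => e p.1 (s b) * σ p.2 b * (e p.1 (t b))⁻¹) '' sW ∈ 𝓝 U₀) ∧
      (∀ p ∈ UZ ×ˢ UV, ∀ sW ∈ 𝓝 p, (fun p : Z × V => fun b : β => e p.1 (s b) * σ p.2 b * (e p.1 (t b))⁻¹) '' sW ∈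
        𝓝 ((fun p : Z × V => fun b : β => e p.1 (s b) * σ p.2 b * (e p.1 (t b))⁻¹) p)) ∧
      Continuous dZ ∧ Continuous dV ∧ (∀ z, 0 ≤ dZ z) ∧ (∀ y, 0 ≤ dV y) ∧ 0 < dZ 0 ∧ 0 < dV 0 ∧
      (∃ σ₀ : ℝ, 0 < σ₀ ∧ ∀ y, dV y =
        σ₀ * |LinearMap.det (jac (lie_adStable_pi C {b // b ∉ F} hlie) (eV y) :
          (piLogChart C {b // b ∉ F}).lie →ₗ[ℝ] (piLogChart C {b // b ∉ F}).lie)|) ∧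
      (Measure.pi fun _ : β => μG).restrict ((fun p : Z × V => fun b : β => e p.1 (s b) * σ p.2 b * (e p.1 (t b))⁻¹) '' (UZ ×ˢ UV)) =
        ((((volume : Measure Z).prod (volume : Measure V)).restrict (UZ ×ˢ UV)).withDensity
            (fun w => ENNReal.ofReal (dZ w.1 * dV w.2))).map
          (fun p : Z × V => fun b : β => e p.1 (s b) * σ p.2 b * (e p.1 (t b))⁻¹) ∧
      UV = eV ⁻¹' Metric.ball (0 : (piLogChart C {b // b ∉ F}).lie) (IsChartRep.chartRadius C / 2) ∧
      (∀ V' : β → G, (∀ (b : β) (hb : b ∉ F),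
          (g U₀ (s b) * U₀ b * (g U₀ (t b))⁻¹)⁻¹ * (g V' (s b) * V' b * (g V' (t b))⁻¹) ∈ h.window (IsChartRep.chartRadius C / 2)) →
        ∃ y ∈ UV, V' = fun b => (g V' (s b))⁻¹ * g U₀ (s b) * σ y b * ((g V' (t b))⁻¹ * g U₀ (t b))⁻¹) := by
  classical
  haveI := finiteDimensional_piLogChart_lie C {x // x ∉ R}
  haveI := finiteDimensional_piLogChart_lie C {b // b ∉ F}
  -- the two factor groups, their Haar measures and framed exponential charts
  set hR := isChartRep_pi {x // x ∉ R} h with hhR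
  set hF := isChartRep_pi {b // b ∉ F} h with hhF
  set νR : Measure ({x // x ∉ R} → G) := Measure.pi fun _ => μG with hνR
  set νF : Measure ({b // b ∉ F} → G) := Measure.pi fun _ => μG with hνF
  obtain ⟨UZ, dZ, hUZo, h0Z, hinjZ, hoZ, hdZc, hdZ0, hdZpos, hchartZ⟩ := exists_haarChart_expChart_frame_open hR (lie_adStable_pi C {x // x ∉ R} hlie) νR eZ
  obtain ⟨σV, hUVo, h0V, hinjV, hoV, hσV, hchartV'⟩ := exists_haarChart_expChart_frame_open_ball hF (lie_adStable_pi C {b // b ∉ F} hlie) νF eV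
  set UV : Set V := eV ⁻¹' Metric.ball (0 : (piLogChart C {b // b ∉ F}).lie) (IsChartRep.chartRadius (piLogChart C {b // b ∉ F}) / 2) with hUV
  -- the free-bond density, written out
  set dV : V → ℝ := fun y => σV * |LinearMap.det (jac (lie_adStable_pi C {b // b ∉ F} hlie) (eV y) :
      (piLogChart C {b // b ∉ F}).lie →ₗ[ℝ] (piLogChart C {b // b ∉ F}).lie)| with hdV
  have hdVc : Continuous dV := continuous_const.mul (continuous_abs.comp ((continuous_det_jac (lie_adStable_pi C {b // b ∉ F} hlie)).comp eV.continuous))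
  have hdV0 : ∀ y, 0 ≤ dV y := fun y => mul_nonneg hσV.le (abs_nonneg _)
  have hdVpos : 0 < dV 0 := by
    show 0 < σV * |LinearMap.det (jac (lie_adStable_pi C {b // b ∉ F} hlie) (eV 0) :
      (piLogChart C {b // b ∉ F}).lie →ₗ[ℝ] (piLogChart C {b // b ∉ F}).lie)|
    rw [map_zero, B13HaarSigmaJacobian.det_jac_zero, abs_one, mul_one]
    exact hσV
  have hchartV : νF.restrict ((fun y => hF.expChart (eV y)) '' UV) =
      (((volume : Measure V).restrict UV).withDensity fun y => ENNReal.ofReal (dV y)).map (fun y => hF.expChart (eV y)) := hchartV'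
  set τZ : Z → ({x // x ∉ R} → G) := fun z => hR.expChart (eZ z) with hτZ
  set τV : V → ({b // b ∉ F} → G) := fun y => hF.expChart (eV y) with hτV
  have hτZc : Continuous τZ := hR.continuous_expChart.comp eZ.continuous
  have hτVc : Continuous τV := hF.continuous_expChart.comp eV.continuous
  have hτZ0 : τZ 0 = 1 := by simp only [hτZ, map_zero, IsChartRep.expChart_zero]
  have hτV0 : τV 0 = 1 := by simp only [hτV, map_zero, IsChartRep.expChart_zero]
  set Ξ : ({x // x ∉ R} → G) × ({b // b ∉ F} → G) → (β → G) := fun p => fun b : β =>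
      (fun x : ι => if hx : x ∈ R then (1 : G) else p.1 ⟨x, hx⟩) (s b) *
        (fun b : β => if hb : b ∈ F then (1 : G) else p.2 ⟨b, hb⟩) b *
        ((fun x : ι => if hx : x ∈ R then (1 : G) else p.1 ⟨x, hx⟩) (t b))⁻¹ with hΞ_def
  set Ψ : (β → G) → ({x // x ∉ R} → G) × ({b // b ∉ F} → G) := fun V =>
    ((fun x : {x // x ∉ R} => (g V x)⁻¹), (fun b : {b // b ∉ F} => g V (s b) * V b * (g V (t b))⁻¹)) with hΨ_def
  have hΞΨ : ∀ V, Ξ (Ψ V) = V := fun V => xi_psi s t R F g hgR hkill V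
  have hΨΞ : ∀ p, Ψ (Ξ p) = p := fun p => psi_xi s t R F g hcov hloc hg1 p.1 p.2
  have hΞc : Continuous Ξ := continuous_xi (G := G) s t R F
  have hΞmp : MeasurePreserving Ξ (νR.prod νF) (Measure.pi fun _ : β => μG) := measurePreserving_xi μG s t R F g hgc.measurable hgR hcov hkill hloc
  -- `Ξ` is a homeomorphism (continuous bijection, compact → Hausdorff)
  set ΞE : (({x // x ∉ R} → G) × ({b // b ∉ F} → G)) ≃ (β → G) := { toFun := Ξ, invFun := Ψ, left_inv := hΨΞ, right_inv := hΞΨ } with hΞE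
  set ΞH : (({x // x ∉ R} → G) × ({b // b ∉ F} → G)) ≃ₜ (β → G) := Continuous.homeoOfEquivCompactToT2 (f := ΞE) hΞc with hΞH
  have hΞH_apply : ∀ p, ΞH p = Ξ p := fun p => rfl
  set w₀ : {x // x ∉ R} → G := (Ψ U₀).1 with hw₀
  set u₀ : {b // b ∉ F} → G := (Ψ U₀).2 with hu₀
  have hq₀ : Ψ U₀ = (w₀, u₀) := rfl
  set ext : ({x // x ∉ R} → G) → (ι → G) := fun w x => if hx : x ∈ R then (1 : G) else w ⟨x, hx⟩ with hext
  have hext_mul : ∀ w w' : {x // x ∉ R} → G, ext (w * w') = ext w * ext w' := by intro w w'; funext x; by_cases hx : x ∈ R <;> simp [hext, hx]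
  have hext_one : ext 1 = 1 := by funext x; by_cases hx : x ∈ R <;> simp [hext, hx]
  have hext_R : ∀ w, ∀ r ∈ R, ext w r = 1 := fun w r hr => by simp [hext, hr]
  have hextc : Continuous ext := by
    refine continuous_pi fun x => ?_
    by_cases hx : x ∈ R
    · simp only [hext, dif_pos hx]; exact continuous_const
    · simp only [hext, dif_neg hx]; exact continuous_apply _
  set e : Z → (ι → G) := fun z => ext w₀ * ext (τZ z) * (ext w₀)⁻¹ with he_def
  set σ : V → (β → G) := fun y => Ξ (w₀, u₀ * τV y) with hσ_def
  set Θ' : Z × V → (β → G) := fun p => fun b : β => e p.1 (s b) * σ p.2 b * (e p.1 (t b))⁻¹ with hΘ'_def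
  -- KEY IDENTITY: `Θ' = Ξ ∘ ((w₀,u₀) · ) ∘ (τZ × τV)`
  have hkey : ∀ p : Z × V, Θ' p = Ξ ((w₀, u₀) * (τZ p.1, τV p.2)) := by
    intro p
    funext b
    simp only [hΘ'_def, he_def, hσ_def, hΞ_def, Prod.mk_mul_mk, Pi.mul_apply, Pi.inv_apply, hext]
    by_cases hs : s b ∈ R <;> by_cases ht : t b ∈ R <;> by_cases hb : b ∈ F
    all_goals simp [hs, ht, hb]
    all_goals group
  set W : Set (Z × V) := UZ ×ˢ UV with hW
  refine ⟨e, σ, UZ, UV, dZ, dV, ?_, ?_, ?_, ?_, ?_, ?_, ?_, ?_, ?_, ?_, ?_, hUZo, hUVo, h0Z, h0V, ?_, ?_, ?_,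
    hdZc, hdVc, hdZ0, hdV0, hdZpos, hdVpos, ⟨σV, hσV, fun y => rfl⟩, ?_, ?_, ?_⟩
  · -- `e` continuous
    exact ((continuous_const.mul (hextc.comp hτZc)).mul continuous_const)
  · -- `e 0 = 1`
    simp only [he_def, hτZ0, hext_one, mul_one, mul_inv_cancel]
  · -- root-trivial
    intro z r hr
    simp only [he_def, Pi.mul_apply, Pi.inv_apply, hext_R _ r hr, mul_one, mul_inv_cancel]
  · -- `e` is onto a neighbourhood of `1` among the root-trivial transformations
    intro sZ hsZ
    have h1 : τZ '' sZ ∈ 𝓝 (1 : {x // x ∉ R} → G) := nhds_one_le_map_expChart_frame hR eZ (Filter.image_mem_map hsZ)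
    -- conjugate by `w₀` and pull back along the restriction map
    set cj : ({x // x ∉ R} → G) ≃ₜ ({x // x ∉ R} → G) := (Homeomorph.mulLeft w₀).trans (Homeomorph.mulRight w₀⁻¹) with hcj
    have hc1 : cj 1 = 1 := by simp only [hcj, Homeomorph.trans_apply, Homeomorph.coe_mulLeft, Homeomorph.coe_mulRight, mul_one, mul_inv_cancel]
    have h2 : cj '' (τZ '' sZ) ∈ 𝓝 (1 : {x // x ∉ R} → G) := by
      have := cj.isOpenMap.image_mem_nhds h1
      rwa [hc1] at this
    set rest : (ι → G) → ({x // x ∉ R} → G) := fun w x => w x with hrest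
    have hrestc : Continuous rest := continuous_pi fun x => continuous_apply _
    have hrest1 : rest 1 = 1 := rfl
    refine ⟨rest ⁻¹' (cj '' (τZ '' sZ)), hrestc.continuousAt.preimage_mem_nhds (by rw [hrest1]; exact h2), ?_⟩
    intro w hw hwR
    obtain ⟨v, ⟨z, hz, rfl⟩, hv⟩ := hw
    refine ⟨z, hz, ?_⟩
    funext x
    by_cases hx : x ∈ R
    · simp only [he_def, Pi.mul_apply, Pi.inv_apply, hext_R _ x hx, mul_one, mul_inv_cancel, hwR x hx]
    · have hvx := congrFun hv ⟨x, hx⟩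
      simp only [hcj, Homeomorph.trans_apply, Homeomorph.coe_mulLeft, Homeomorph.coe_mulRight, hrest] at hvx
      simp only [he_def, Pi.mul_apply, Pi.inv_apply, hext, dif_neg hx]
      simpa using hvx
  · -- `σ` continuous
    exact hΞc.comp (continuous_const.prodMk (continuous_const.mul hτVc))
  · -- `σ 0 = U₀`
    simp only [hσ_def, hτV0, mul_one]
    rw [← hq₀]; exact hΞΨ U₀
  · -- `σ` is smooth through `ρ`: bondwise `const · exp(linear) · const` in `𝔸`
    have hexp : ContDiff ℝ ⊤ (NormedSpace.exp : 𝔸 → 𝔸) := contDiff_iff_contDiffAt.2 fun x => (NormedSpace.exp_analytic (𝕂 := ℝ) x).contDiffAt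
    refine contDiff_pi.2 fun b => ?_
    have hσb : ∀ y : V, ρ (σ y b) = ρ (ext w₀ (s b)) *
        ρ ((fun b : β => if hb : b ∈ F then (1 : G) else (u₀ * τV y) ⟨b, hb⟩) b) * ρ ((ext w₀ (t b))⁻¹) := by
      intro y; simp only [hσ_def, hΞ_def, hext, map_mul]
    rw [show (fun y : V => ρ (σ y b)) = fun y => ρ (ext w₀ (s b)) *
        ρ ((fun b : β => if hb : b ∈ F then (1 : G) else (u₀ * τV y) ⟨b, hb⟩) b) * ρ ((ext w₀ (t b))⁻¹) from funext hσb]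
    refine (contDiff_const.mul ?_).mul contDiff_const
    by_cases hb : b ∈ F
    · simp only [dif_pos hb, map_one]; exact contDiff_const
    · simp only [dif_neg hb, Pi.mul_apply, map_mul]
      refine contDiff_const.mul ?_
      -- `ρ (τV y ⟨b, hb⟩) = exp (a linear function of y)`
      set L : V →ₗ[ℝ] 𝔸 := C.lie.subtype ∘ₗ (LinearMap.proj (R := ℝ) (φ := fun _ : {b // b ∉ F} => C.lie) ⟨b, hb⟩ ∘ₗ
        ((lieEquivPi C {b // b ∉ F}).toLinearMap ∘ₗ (eV : V ≃L[ℝ] (piLogChart C {b // b ∉ F}).lie).toLinearEquiv.toLinearMap)) with hL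
      have hρτ : (fun y : V => ρ (τV y ⟨b, hb⟩)) = fun y => NormedSpace.exp (LinearMap.toContinuousLinearMap L y) := by
        funext y
        show ρ ((isChartRep_pi {b // b ∉ F} h).expChart (eV y) ⟨b, hb⟩) = _
        rw [expChart_pi_apply (B := {b // b ∉ F}) h, h.rho_expChart]
        rfl
      rw [hρτ]
      exact hexp.comp (LinearMap.toContinuousLinearMap L).contDiff
  · -- (σ-comb) the transversal moves no comb bond
    intro y b hb
    have hU₀ : Ξ (w₀, u₀) = U₀ := by rw [← hq₀]; exact hΞΨ U₀
    rw [← congrFun hU₀ b]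
    simp only [hσ_def, hΞ_def, dif_pos hb]
  · -- (σ-transporter) the transporter is constant along the transversal: `Ψ(σ y).1 = w₀ = Ψ(U₀).1`
    intro y
    have hΨσ : Ψ (σ y) = (w₀, u₀ * τV y) := hΨΞ (w₀, u₀ * τV y)
    funext x
    by_cases hx : x ∈ R
    · rw [hgR _ x hx, hgR _ x hx]
    · have h1 : (g (σ y) x)⁻¹ = w₀ ⟨x, hx⟩ := by
        have := congrFun (congrArg Prod.fst hΨσ) ⟨x, hx⟩
        simpa only [hΨ_def] using this
      have h2 : (g U₀ x)⁻¹ = w₀ ⟨x, hx⟩ := rfl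
      exact inv_injective (h1.trans h2.symm)
  · -- (F4a) THE BONDWISE FORMULA: `σ y b = U₀ b · ((g U₀ (t b))⁻¹ · Θ((eV y)_b) · g U₀ (t b))` on the free bonds
    intro y b hb
    have hw : ∀ x, (if hx : x ∈ R then (1 : G) else w₀ ⟨x, hx⟩) = (g U₀ x)⁻¹ := by
      intro x
      by_cases hx : x ∈ R
      · rw [dif_pos hx, hgR U₀ x hx, inv_one]
      · rw [dif_neg hx]
    have hτ : τV y ⟨b, hb⟩ = h.expChart (lieApply C {b // b ∉ F} (eV y) ⟨b, hb⟩) := expChart_pi_apply {b // b ∉ F} h (eV y) ⟨b, hb⟩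
    have hu : u₀ ⟨b, hb⟩ = g U₀ (s b) * U₀ b * (g U₀ (t b))⁻¹ := rfl
    have hΞb : σ y b = (if hx : s b ∈ R then (1 : G) else w₀ ⟨s b, hx⟩) * (u₀ ⟨b, hb⟩ * τV y ⟨b, hb⟩) *
        (if hx : t b ∈ R then (1 : G) else w₀ ⟨t b, hx⟩)⁻¹ := by
      simp only [hσ_def, hΞ_def, dif_neg hb, Pi.mul_apply]
    rw [hΞb, hw, hw, hτ, hu]
    group
  · -- (σ-growth) in the free-bond tree coordinates the transversal IS the exponential chart: `(Ψ U₀).2⁻¹ · (Ψ (σ y)).2 = Θ^{β∖F}(eV y)`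
    obtain ⟨c, hc, hev⟩ := exists_sq_norm_le_sum_norm_exp_sub_one_sq C eV
    refine ⟨c, hc, ?_⟩
    filter_upwards [hev] with y hy
    have hΨσ : Ψ (σ y) = (w₀, u₀ * τV y) := hΨΞ (w₀, u₀ * τV y)
    have hterm : ∀ b : {b // b ∉ F},
        ρ ((g U₀ (s b) * U₀ b * (g U₀ (t b))⁻¹)⁻¹ * (g (σ y) (s b) * σ y b * (g (σ y) (t b))⁻¹)) =
          NormedSpace.exp (((eV y : (piLogChart C {b // b ∉ F}).lie) : {b // b ∉ F} → 𝔸) b) := by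
      intro b
      have h1 : g (σ y) (s b) * σ y b * (g (σ y) (t b))⁻¹ = u₀ b * τV y b := by
        have := congrFun (congrArg Prod.snd hΨσ) b
        simpa only [hΨ_def, Pi.mul_apply] using this
      have h2 : g U₀ (s b) * U₀ b * (g U₀ (t b))⁻¹ = u₀ b := rfl
      rw [h1, h2, ← mul_assoc, inv_mul_cancel, one_mul]
      show ρ ((isChartRep_pi {b // b ∉ F} h).expChart (eV y) b) = _
      rw [expChart_pi_apply (B := {b // b ∉ F}) h, h.rho_expChart]
      rfl
    calc c * ‖y‖ ^ 2 ≤ _ := hy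
      _ = _ := Finset.sum_congr rfl fun b _ => by rw [hterm b]
  · -- injectivity on the window
    intro p hp p' hp' hpp
    have h1 : Ξ ((w₀, u₀) * (τZ p.1, τV p.2)) = Ξ ((w₀, u₀) * (τZ p'.1, τV p'.2)) := by rw [← hkey, ← hkey]; exact hpp
    have h2 := mul_left_cancel (ΞE.injective h1)
    simp only [Prod.mk.injEq] at h2
    exact Prod.ext (hinjZ hp.1 hp'.1 h2.1) (hinjV hp.2 hp'.2 h2.2)
  · -- openness at the origin
    intro sW hsW
    have hτ : (fun p : Z × V => (τZ p.1, τV p.2)) '' sW ∈ 𝓝 ((1 : {x // x ∉ R} → G), (1 : {b // b ∉ F} → G)) := by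
      have hle : 𝓝 ((1 : {x // x ∉ R} → G), (1 : {b // b ∉ F} → G)) ≤
          map (fun p : Z × V => (τZ p.1, τV p.2)) (𝓝 ((0 : Z), (0 : V))) := by
        rw [nhds_prod_eq, nhds_prod_eq, ← Filter.prod_map_map_eq]
        exact Filter.prod_mono (nhds_one_le_map_expChart_frame hR eZ) (nhds_one_le_map_expChart_frame hF eV)
      exact hle (Filter.image_mem_map hsW)
    have hL : (fun q => (w₀, u₀) * q) '' ((fun p : Z × V => (τZ p.1, τV p.2)) '' sW) ∈ 𝓝 ((w₀, u₀) : ({x // x ∉ R} → G) × ({b // b ∉ F} → G)) := by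
      have := (Homeomorph.mulLeft ((w₀, u₀) : ({x // x ∉ R} → G) × ({b // b ∉ F} → G))).isOpenMap.image_mem_nhds hτ
      simpa using this
    have hΞo : Ξ '' ((fun q => (w₀, u₀) * q) '' ((fun p : Z × V => (τZ p.1, τV p.2)) '' sW)) ∈ 𝓝 (Ξ (w₀, u₀)) := by
      have := ΞH.isOpenMap.image_mem_nhds hL
      simpa [hΞH_apply] using this
    have hU₀ : Ξ (w₀, u₀) = U₀ := by rw [← hq₀]; exact hΞΨ U₀
    rw [hU₀] at hΞo
    refine Filter.mem_of_superset hΞo ?_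
    rintro _ ⟨_, ⟨_, ⟨p, hp, rfl⟩, rfl⟩, rfl⟩
    exact ⟨p, hp, hkey p⟩
  · -- (F3) openness at EVERY point of the window: the two framed exponential charts are open on `UZ` ∕ `UV` (✓`…ExpChartOpen`), then translate and `Ξ`
    rintro p ⟨hpZ, hpV⟩ sW hsW
    obtain ⟨N1, hN1, N2, hN2, hsub⟩ := mem_nhds_prod_iff.1 hsW
    have h1 : τZ '' N1 ∈ 𝓝 (τZ p.1) := hoZ p.1 hpZ N1 hN1
    have h2 : τV '' N2 ∈ 𝓝 (τV p.2) := hoV p.2 hpV N2 hN2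
    have hτ : (fun p : Z × V => (τZ p.1, τV p.2)) '' sW ∈ 𝓝 (τZ p.1, τV p.2) := by
      refine Filter.mem_of_superset (prod_mem_nhds h1 h2) ?_
      rintro ⟨a, b⟩ ⟨⟨z, hz, rfl⟩, ⟨y, hy, rfl⟩⟩
      exact ⟨(z, y), hsub (Set.mk_mem_prod hz hy), rfl⟩
    have hL : (fun q => (w₀, u₀) * q) '' ((fun p : Z × V => (τZ p.1, τV p.2)) '' sW) ∈
        𝓝 (((w₀, u₀) : ({x // x ∉ R} → G) × ({b // b ∉ F} → G)) * (τZ p.1, τV p.2)) := by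
      have := (Homeomorph.mulLeft ((w₀, u₀) : ({x // x ∉ R} → G) × ({b // b ∉ F} → G))).isOpenMap.image_mem_nhds hτ
      simpa using this
    have hΞo : Ξ '' ((fun q => (w₀, u₀) * q) '' ((fun p : Z × V => (τZ p.1, τV p.2)) '' sW)) ∈
        𝓝 (Ξ (((w₀, u₀) : ({x // x ∉ R} → G) × ({b // b ∉ F} → G)) * (τZ p.1, τV p.2))) := by
      have := ΞH.isOpenMap.image_mem_nhds hL
      simpa [hΞH_apply] using this
    show Θ' '' sW ∈ 𝓝 (Θ' p)
    rw [hkey p]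
    refine Filter.mem_of_superset hΞo ?_
    rintro _ ⟨_, ⟨_, ⟨q, hq, rfl⟩, rfl⟩, rfl⟩
    exact ⟨q, hq, hkey q⟩
  · -- THE CHART IDENTITY
    haveI : (νR.prod νF).IsMulLeftInvariant := inferInstance
    -- (1) the product of the two frame charts
    have hτm : Measurable (fun p : Z × V => (τZ p.1, τV p.2)) := (hτZc.prodMap hτVc).measurable
    have hdZm : Measurable fun z => ENNReal.ofReal (dZ z) := ENNReal.measurable_ofReal.comp hdZc.measurable
    have hdVm : Measurable fun y => ENNReal.ofReal (dV y) := ENNReal.measurable_ofReal.comp hdVc.measurable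
    have hprod : (νR.prod νF).restrict ((fun p : Z × V => (τZ p.1, τV p.2)) '' W) =
        ((((volume : Measure Z).prod (volume : Measure V)).restrict W).withDensity
            (fun w => ENNReal.ofReal (dZ w.1 * dV w.2))).map
          (fun p : Z × V => (τZ p.1, τV p.2)) := by
      have himg : (fun p : Z × V => (τZ p.1, τV p.2)) '' W = (τZ '' UZ) ×ˢ (τV '' UV) := by rw [hW]; exact Set.prodMap_image_prod τZ τV UZ UV
      rw [himg, ← Measure.prod_restrict, hchartZ, hchartV,
        Measure.map_prod_map _ _ hτZc.measurable hτVc.measurable,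
        prod_withDensity hdZm hdVm, Measure.prod_restrict, ← hW]
      congr 1
      refine withDensity_congr_ae (Filter.Eventually.of_forall fun p => ?_)
      show ENNReal.ofReal (dZ p.1) * ENNReal.ofReal (dV p.2) = ENNReal.ofReal (dZ p.1 * dV p.2)
      rw [ENNReal.ofReal_mul (hdZ0 _)]
    -- (2) left translation in the product group is Haar-preserving and a measurable embedding
    have hLmp : MeasurePreserving (fun q => ((w₀, u₀) : ({x // x ∉ R} → G) × ({b // b ∉ F} → G)) * q) (νR.prod νF) (νR.prod νF) :=
      measurePreserving_mul_left _ _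
    have hLemb : MeasurableEmbedding (fun q => ((w₀, u₀) : ({x // x ∉ R} → G) × ({b // b ∉ F} → G)) * q) :=
      (Homeomorph.mulLeft ((w₀, u₀) : ({x // x ∉ R} → G) × ({b // b ∉ F} → G))).measurableEmbedding
    have hL := (hLmp.restrict_image_emb hLemb ((fun p : Z × V => (τZ p.1, τV p.2)) '' W)).map_eq
    -- (3) `Ξ` is measure preserving and a measurable embedding (homeomorphism)
    have hΞemb : MeasurableEmbedding Ξ := by
      have hco : (ΞH : (({x // x ∉ R} → G) × ({b // b ∉ F} → G)) → (β → G)) = Ξ := funext hΞH_apply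
      rw [← hco]
      exact ΞH.measurableEmbedding
    have hX := (hΞmp.restrict_image_emb hΞemb
      ((fun q => ((w₀, u₀) : ({x // x ∉ R} → G) × ({b // b ∉ F} → G)) * q) '' ((fun p : Z × V => (τZ p.1, τV p.2)) '' W))).map_eq
    have hΘ'eq : Θ' = Ξ ∘ (fun q => ((w₀, u₀) : ({x // x ∉ R} → G) × ({b // b ∉ F} → G)) * q) ∘ (fun p : Z × V => (τZ p.1, τV p.2)) := by funext p; exact hkey p
    have himg3 : Θ' '' W = Ξ '' ((fun q => ((w₀, u₀) : ({x // x ∉ R} → G) × ({b // b ∉ F} → G)) * q) '' ((fun p : Z × V => (τZ p.1, τV p.2)) '' W)) := by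
      rw [hΘ'eq, Set.image_comp, Set.image_comp]
    show (Measure.pi fun _ : β => μG).restrict (Θ' '' W) =
      ((((volume : Measure Z).prod (volume : Measure V)).restrict W).withDensity (fun w => ENNReal.ofReal (dZ w.1 * dV w.2))).map Θ'
    rw [himg3, ← hX, ← hL, hprod, Measure.map_map hLemb.measurable hτm, Measure.map_map hΞemb.measurable (hLemb.measurable.comp hτm), hΘ'eq]
  · -- (F5) THE WINDOW NAMED: `UV = eV ⁻¹' B(0, s_C∕2)` (the product chart has the one-bond chart radius)
    rw [hUV, chartRadius_piLogChart C {b // b ∉ F}]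
  · -- (F6) COVER ∕ INNER RADIUS: a field with comb-gauge free-bond readings in the canonical windows is a residual transform of a transversal point
    intro V' hV'
    have hX : ∀ b : {b // b ∉ F}, ∃ X : C.lie, ‖X‖ < IsChartRep.chartRadius C / 2 ∧
        h.expChart X = (g U₀ (s b) * U₀ b * (g U₀ (t b))⁻¹)⁻¹ * (g V' (s b) * V' b * (g V' (t b))⁻¹) := fun b => by
      obtain ⟨X, hXs, hXe⟩ := hV' b b.2; exact ⟨X, mem_ball_zero_iff.1 hXs, hXe⟩
    choose X hXn hXe using hX
    set A : (piLogChart C {b // b ∉ F}).lie := (lieEquivPi C {b // b ∉ F}).symm X with hA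
    have hAb : ∀ b, lieApply C {b // b ∉ F} A b = X b := fun b =>
      congrFun ((lieEquivPi C {b // b ∉ F}).apply_symm_apply X) b
    have hAn : ‖A‖ < IsChartRep.chartRadius C / 2 :=
      (HaarWindowConstLimit.norm_lt_iff_pi {b // b ∉ F} (half_pos IsChartRep.chartRadius_pos) A).2 fun b => by rw [hAb]; exact hXn b
    have heVy : eV (eV.symm A) = A := eV.apply_symm_apply A
    have hyUV : eV.symm A ∈ UV := by rw [hUV, Set.mem_preimage, heVy, mem_ball_zero_iff, chartRadius_piLogChart C {b // b ∉ F}]; exact hAn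
    -- in the free-bond tree coordinates, `u₀ · Θ^{β∖F}(A)` IS the free reading of `V'`
    have hτy : u₀ * τV (eV.symm A) = (Ψ V').2 := by
      funext b
      have h1 : τV (eV.symm A) b = h.expChart (X b) := by
        show (isChartRep_pi {b // b ∉ F} h).expChart (eV (eV.symm A)) b = _; rw [heVy, expChart_pi_apply (B := {b // b ∉ F}) h, hAb]
      rw [Pi.mul_apply, h1, hXe, show (Ψ V').2 b = g V' (s b) * V' b * (g V' (t b))⁻¹ from rfl,
        show u₀ b = g U₀ (s b) * U₀ b * (g U₀ (t b))⁻¹ from rfl, ← mul_assoc, mul_inv_cancel, one_mul]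
    refine ⟨eV.symm A, hyUV, ?_⟩
    -- `V' = Ξ (Ψ V') = Ξ ((g V')⁻¹, u₀ · τV y)` against `σ y = Ξ ((g U₀)⁻¹, u₀ · τV y)`: conjugate by the root-trivial `(g V')⁻¹ · g U₀`
    have hV' : V' = Ξ ((Ψ V').1, u₀ * τV (eV.symm A)) := by rw [hτy]; exact (hΞΨ V').symm
    funext b
    conv_lhs => rw [hV']
    simp only [hσ_def, hΞ_def, hw₀, hΨ_def, Pi.mul_apply]
    by_cases hs : s b ∈ R <;> by_cases ht : t b ∈ R
    · simp [hs, ht, hgR V' (s b) hs, hgR U₀ (s b) hs, hgR V' (t b) ht, hgR U₀ (t b) ht]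
    · simp [hs, ht, hgR V' (s b) hs, hgR U₀ (s b) hs]
    · simp [hs, ht, hgR V' (t b) ht, hgR U₀ (t b) ht]
    · simp [hs, ht]; group

end Summit.QuantumFields.YangMills.Theorems.FluctuationComparisonRegPrIntLS2BetaTreeGaugeChartLocalCover

end
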